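import Literature.Analysis.FluidPDE.AncientL3BackwardLiouvilleHolds
import Literature.Analysis.UnboundedOperators.HeatKernelLpSmoothingProofs
import Summits.NavierStokesRegularity.NavierStokesRegularity.Theorems.TypeILiouvilleTypeIliouvilleLStubOseenConstBoost
import HarnessLib

/-!
# `Lᵖ` recurrence to a constant drift in the far past, `0 < p ≤ 3`, forces a mild bounded ancient
# solution to be that drift (crux `TypeIliouvilleL`, stmt-NavierStokesRegularity-10661, stub S3ᵐ)

Helper file for the registered persistent-regime stub
`stub_persistent_mild_backward_L3_recurrence` (S3ᵐ) of the crux `TypeIliouvilleL` (= the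
Liouville conjecture (L) of Koch–Nadirashvili–Seregin–Šverák 2009 in print's class of mild bounded
ancient solutions): theorems only, no definition, no named fact, no `sorry`; lands
`--supports stmt-NavierStokesRegularity-10661`.

S3ᵐ asks that a mild bounded ancient `v` outside the Type-I regime be `L³`-close (`≤ M`) to
constants `b_k` along times `τ_k → −∞`; the composition then kills `v` to a constant through
Albritton–Barker 2019, Thm 1.2 (`Literature.Analysis.FluidPDE.AlbrittonBarker2019_liouville_L3_backward`,
proved in the tree). This file records that the EXPONENT `3` is not load-bearing from below:

* `norm_const_le_of_eLpNorm_sub_lt_top` — if `‖f‖ ≤ K` pointwise and `f − b ∈ Lᵖ(ℝ³)` for some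
  `0 < p < ∞`, then `‖b‖ ≤ K` (Lebesgue measure of `ℝ³` is infinite);
* `eLpNorm_le_rpow_mul_rpow_of_norm_le` — `Lᵖ ∩ L^∞ ⊂ L^q`, `p ≤ q`, with the explicit bound
  `‖f‖_q ≤ ‖f‖_p^{p/q} A^{1−p/q}` for `‖f‖ ≤ A` (tree interpolation
  `UnboundedOperators.eLpNorm_le_eLpNorm_rpow_mul_eLpNorm_top_rpow`);
* `oseenMild_const_of_backward_Lp_const` — **a mild bounded ancient solution which, along some
  `τ_k → −∞`, is an `Lᵖ` perturbation (`0 < p ≤ 3`, norms `≤ M < ∞`) of ONE constant drift `b`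
  is the drift `b`**: interpolate to `L³` with the uniform sup bound `K + ‖b‖`, boost by `b`
  (`stub_oseen_const_boost`) and apply Albritton–Barker; `p = 2` is the finite-energy case
  (`oseenMild_const_of_backward_finiteEnergy_const`): an ancient flow that is recurrently a
  bounded-energy perturbation of a uniform stream is the uniform stream;
* `persistentMild_of_persistentLp` — for `0 < p ≤ 3` the statement "S3ᵐ with `L³` replaced by `Lᵖ`"
  IMPLIES the registered S3ᵐ verbatim (varying constants `b_k`: `‖b_k‖ ≤ K` by the first lemma, so
  the sup bound `2K` is uniform), and `persistentLp_of_persistentMild` — for `3 ≤ p < ∞` the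
  registered S3ᵐ implies its `Lᵖ` variant. So the `Lᵖ`-recurrence statements are monotone in `p`
  on `(0, ∞)`, and any one of them with `p ≤ 3` (e.g. the energy class `p = 2`) closes S3ᵐ.

Nothing here proves S3ᵐ, (L), or anything about Navier–Stokes regularity.
-/

set_option linter.dupNamespace false

namespace Summit.NavierStokesRegularity.NavierStokesRegularity.Theorems

open MeasureTheory Filter Set Function
open scoped ENNReal NNReal Topology
open Literature.Analysis Literature.Analysis.FluidPDE

namespace TypeIliouvilleL.PersistentLp

/-- If `‖f x‖ ≤ K` for every `x ∈ ℝ³` and `f − b ∈ Lᵖ(ℝ³)` for some exponent `0 < p < ∞`, then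
`‖b‖ ≤ K`: otherwise `‖f − b‖ ≥ ‖b‖ − K > 0` everywhere and a positive constant has infinite `Lᵖ`
seminorm on `ℝ³` (infinite Lebesgue measure). -/
theorem norm_const_le_of_eLpNorm_sub_lt_top
    {f : EuclideanSpace ℝ (Fin 3) → EuclideanSpace ℝ (Fin 3)} {K : ℝ}
    (hf : ∀ x, ‖f x‖ ≤ K) {b : EuclideanSpace ℝ (Fin 3)} {p : ℝ≥0∞} (hp0 : p ≠ 0) (hpt : p ≠ ∞)
    (hfin : eLpNorm (fun x => f x - b) p (volume : Measure (EuclideanSpace ℝ (Fin 3))) < ∞) :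
    ‖b‖ ≤ K := by
  by_contra hK
  push Not at hK
  set δ : ℝ := ‖b‖ - K with hδ
  have hδ0 : 0 < δ := by rw [hδ]; linarith
  have hle : ∀ x, ‖(fun _ : EuclideanSpace ℝ (Fin 3) => δ) x‖ ≤ ‖(fun x => f x - b) x‖ := by
    intro x
    have h1 : ‖b‖ - ‖f x‖ ≤ ‖f x - b‖ := by
      rw [← norm_neg (f x - b), neg_sub]
      exact norm_sub_norm_le b (f x)
    have h2 : δ ≤ ‖f x - b‖ := by linarith [hf x]
    simpa [Real.norm_eq_abs, abs_of_pos hδ0] using h2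
  have hmono := eLpNorm_mono (μ := (volume : Measure (EuclideanSpace ℝ (Fin 3)))) (p := p) hle
  have hconst : eLpNorm (fun _ : EuclideanSpace ℝ (Fin 3) => δ) p
      (volume : Measure (EuclideanSpace ℝ (Fin 3))) = ∞ := by
    rw [eLpNorm_const δ hp0 (NeZero.ne _), measure_univ_of_isAddLeftInvariant,
      ENNReal.top_rpow_of_pos (one_div_pos.2 (ENNReal.toReal_pos hp0 hpt)), ENNReal.mul_top]
    have : ‖δ‖ₑ ≠ 0 := by
      rw [ne_eq, enorm_eq_zero]
      exact hδ0.ne'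
    exact this
  rw [hconst, top_le_iff] at hmono
  exact (lt_irrefl _) (hmono ▸ hfin)

/-- `Lᵖ ∩ L^∞ ⊂ L^q` for `0 < p ≤ q`, quantitatively: if `‖f x‖ ≤ A` for all `x` then
`‖f‖_q ≤ ‖f‖_p^{p/q} · A^{1 − p/q}` (real exponents `p.toReal / q.toReal`; for `q = ∞` both sides
read through `toReal ∞ = 0`). -/
theorem eLpNorm_le_rpow_mul_rpow_of_norm_le
    {f : EuclideanSpace ℝ (Fin 3) → EuclideanSpace ℝ (Fin 3)}
    (hfm : AEStronglyMeasurable f (volume : Measure (EuclideanSpace ℝ (Fin 3))))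
    {A : ℝ} (hA : ∀ x, ‖f x‖ ≤ A) {p q : ℝ≥0∞} (hp0 : p ≠ 0) (hpq : p ≤ q) :
    eLpNorm f q (volume : Measure (EuclideanSpace ℝ (Fin 3))) ≤
      eLpNorm f p (volume : Measure (EuclideanSpace ℝ (Fin 3))) ^ (p.toReal / q.toReal) *
        ENNReal.ofReal A ^ (1 - p.toReal / q.toReal) := by
  have h1 := UnboundedOperators.eLpNorm_le_eLpNorm_rpow_mul_eLpNorm_top_rpow
    (μ := (volume : Measure (EuclideanSpace ℝ (Fin 3)))) hfm hp0 hpq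
  have htop : eLpNorm f ∞ (volume : Measure (EuclideanSpace ℝ (Fin 3))) ≤ ENNReal.ofReal A := by
    rw [eLpNorm_exponent_top]
    exact eLpNormEssSup_le_of_ae_bound (Eventually.of_forall hA)
  have hexp : 0 ≤ 1 - p.toReal / q.toReal := by
    rcases eq_or_ne q ∞ with rfl | hq
    · simp
    · have hp' : p ≠ ∞ := ne_top_of_le_ne_top hq hpq
      have hq0 : q ≠ 0 := (lt_of_lt_of_le (pos_iff_ne_zero.2 hp0) hpq).ne'
      have hb : 0 < q.toReal := ENNReal.toReal_pos hq0 hq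
      have hab : p.toReal ≤ q.toReal := (ENNReal.toReal_le_toReal hp' hq).2 hpq
      rw [sub_nonneg, div_le_one hb]
      exact hab
  exact h1.trans (mul_le_mul' le_rfl (ENNReal.rpow_le_rpow htop hexp))

/-- For `0 < p ≤ 3`: the interpolation exponents `p/3` and `1 − p/3` are nonnegative. -/
theorem exponents_nonneg {p : ℝ≥0∞} (hp3 : p ≤ 3) :
    0 ≤ p.toReal / (3 : ℝ≥0∞).toReal ∧ 0 ≤ 1 - p.toReal / (3 : ℝ≥0∞).toReal := by
  refine ⟨by positivity, ?_⟩
  have h3 : p.toReal ≤ (3 : ℝ≥0∞).toReal := ENNReal.toReal_mono (by norm_num) hp3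
  have e3 : (3 : ℝ≥0∞).toReal = 3 := by norm_num
  rw [e3] at h3 ⊢
  rw [sub_nonneg, div_le_one (by norm_num : (0 : ℝ) < 3)]
  exact h3

/-- **Uniform `L³` bound from a uniform `Lᵖ` bound, `0 < p ≤ 3`, under a pointwise bound.** If
`‖f x‖ ≤ A` everywhere and `‖f‖_p ≤ M` then `‖f‖₃ ≤ M^{p/3} A^{1−p/3}`. -/
theorem eLpNorm_three_le_of_eLpNorm_le
    {f : EuclideanSpace ℝ (Fin 3) → EuclideanSpace ℝ (Fin 3)}
    (hfm : AEStronglyMeasurable f (volume : Measure (EuclideanSpace ℝ (Fin 3))))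
    {A : ℝ} (hA : ∀ x, ‖f x‖ ≤ A) {p : ℝ≥0∞} (hp0 : p ≠ 0) (hp3 : p ≤ 3) {M : ℝ≥0∞}
    (hM : eLpNorm f p (volume : Measure (EuclideanSpace ℝ (Fin 3))) ≤ M) :
    eLpNorm f 3 (volume : Measure (EuclideanSpace ℝ (Fin 3))) ≤
      M ^ (p.toReal / (3 : ℝ≥0∞).toReal) * ENNReal.ofReal A ^ (1 - p.toReal / (3 : ℝ≥0∞).toReal) :=
  (eLpNorm_le_rpow_mul_rpow_of_norm_le hfm hA hp0 hp3).trans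
    (mul_le_mul' (ENNReal.rpow_le_rpow hM (exponents_nonneg hp3).1) le_rfl)

end TypeIliouvilleL.PersistentLp

open TypeIliouvilleL.PersistentLp

/-- **Backward `Lᵖ` recurrence to one constant drift kills a mild bounded ancient solution
(`0 < p ≤ 3`).** Let `v` be continuous and uniformly bounded on `(−∞,0) × ℝ³`, weakly divergence
free on every slice and Oseen-mild (`v(t) = e^{(t−s)Δ}v(s) − B¹_s(v,v)(t)` for all `s < t < 0`:
print's mild bounded ancient solutions, KNSS 2009 §4 (i)). If for one constant vector `b`, one
exponent `0 < p ≤ 3`, some negative times `τ_k → −∞` and a finite `M` one has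
`‖v(τ_k) − b‖_{Lᵖ(ℝ³)} ≤ M` for all `k`, then `v(t,x) = b` for all `t < 0` and all `x`. Proof: with
the sup bound `K + ‖b‖` the `Lᵖ` bound interpolates to a uniform `L³` bound
(`eLpNorm_three_le_of_eLpNorm_le`); the Galilean boost `w(t,y) = v(t, y + t•b) − b` is again a mild
bounded ancient solution (`stub_oseen_const_boost`) with the same `L³` norms (translation
invariance), and Albritton–Barker 2019, Thm 1.2 (`AlbrittonBarker2019_liouville_L3_backward_holds`)
gives `w ≡ 0`. [cite: AlbrittonBarker2019, Thm 1.2 (arXiv:1811.00502 p. 4)] -/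
theorem oseenMild_const_of_backward_Lp_const
    (v : ℝ → EuclideanSpace ℝ (Fin 3) → EuclideanSpace ℝ (Fin 3)) (b : EuclideanSpace ℝ (Fin 3))
    {p : ℝ≥0∞} (hp0 : p ≠ 0) (hp3 : p ≤ 3)
    (hvc : ContinuousOn (uncurry v) (Iio 0 ×ˢ univ))
    (hvK : ∃ K : ℝ, ∀ t < 0, ∀ x, ‖v t x‖ ≤ K)
    (hvd : ∀ t < 0, IsWeaklyDivFree (v t))
    (hvm : ∀ s t : ℝ, s < t → t < 0 → ∀ x,
      v t x = UnboundedOperators.heatExtension (v s) (t - s) x - oseenDuhamel 1 s v v t x)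
    (hLp : ∃ (τ : ℕ → ℝ) (M : ℝ≥0∞), M < ∞ ∧ Tendsto τ atTop atBot ∧ (∀ k, τ k < 0) ∧
      ∀ k, eLpNorm (fun x => v (τ k) x - b) p (volume : Measure (EuclideanSpace ℝ (Fin 3))) ≤ M) :
    ∀ t < 0, ∀ x, v t x = b := by
  obtain ⟨τ, M, hM, hτlim, hτ0, hLp⟩ := hLp
  obtain ⟨K, hK⟩ := hvK
  have hvcont : ∀ k, Continuous (v (τ k)) := fun k =>
    hvc.comp_continuous (Continuous.prodMk_right (τ k)) fun x => mem_prod.2 ⟨hτ0 k, mem_univ x⟩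
  -- uniform pointwise bound of the perturbation
  have hA : ∀ k x, ‖v (τ k) x - b‖ ≤ K + ‖b‖ := fun k x =>
    (norm_sub_le _ _).trans (add_le_add (hK _ (hτ0 k) x) le_rfl)
  -- uniform `L³` bound
  set M' : ℝ≥0∞ := M ^ (p.toReal / (3 : ℝ≥0∞).toReal) *
    ENNReal.ofReal (K + ‖b‖) ^ (1 - p.toReal / (3 : ℝ≥0∞).toReal) with hM'
  have hM'top : M' < ∞ :=
    ENNReal.mul_lt_top (ENNReal.rpow_lt_top_of_nonneg (exponents_nonneg hp3).1 hM.ne)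
      (ENNReal.rpow_lt_top_of_nonneg (exponents_nonneg hp3).2 ENNReal.ofReal_ne_top)
  have hL3 : ∀ k, eLpNorm (fun x => v (τ k) x - b) 3
      (volume : Measure (EuclideanSpace ℝ (Fin 3))) ≤ M' := fun k =>
    eLpNorm_three_le_of_eLpNorm_le ((hvcont k).sub continuous_const).aestronglyMeasurable
      (hA k) hp0 hp3 (hLp k)
  -- the boosted field
  set w : ℝ → EuclideanSpace ℝ (Fin 3) → EuclideanSpace ℝ (Fin 3) := fun t y => v t (y + t • b) - b
    with hw_def
  obtain ⟨hwc, hwK, hwd, hwm⟩ := stub_oseen_const_boost v b hvc ⟨K, hK⟩ hvd hvm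
  have hwL3 : ∀ k, eLpNorm (w (τ k)) 3 (volume : Measure (EuclideanSpace ℝ (Fin 3))) ≤ M' := by
    intro k
    have h1 : eLpNorm (fun y => v (τ k) (y + τ k • b) - b) 3
          (volume : Measure (EuclideanSpace ℝ (Fin 3))) =
        eLpNorm (fun y => v (τ k) y - b) 3 (volume : Measure (EuclideanSpace ℝ (Fin 3))) :=
      -- translation invariance of Lebesgue measure (as in `TypeIliouvilleL.BackwardL3`)
      eLpNorm_comp_measurePreserving (p := (3 : ℝ≥0∞)) (g := fun y => v (τ k) y - b)
        ((hvcont k).sub continuous_const).aestronglyMeasurable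
        (measurePreserving_add_right (volume : Measure (EuclideanSpace ℝ (Fin 3))) (τ k • b))
    show eLpNorm (fun y => v (τ k) (y + τ k • b) - b) 3
      (volume : Measure (EuclideanSpace ℝ (Fin 3))) ≤ M'
    rw [h1]
    exact hL3 k
  -- Albritton–Barker: `w ≡ 0`
  have hw0 : ∀ t < 0, ∀ x, w t x = 0 :=
    AlbrittonBarker2019_liouville_L3_backward_holds hwc hwK hwd hwm ⟨τ, M', hM'top, hτlim, hτ0, hwL3⟩
  intro t ht z
  have h := hw0 t ht (z - t • b)
  simp only [hw_def, sub_add_cancel, sub_eq_zero] at h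
  exact h

/-- **Finite-energy case (`p = 2`).** A mild bounded ancient solution which along some `τ_k → −∞`
is a finite-energy perturbation of one uniform stream `b` with bounded energy,
`‖v(τ_k) − b‖_{L²(ℝ³)} ≤ M < ∞`, is the uniform stream: `v ≡ b` on `(−∞,0) × ℝ³`.
[cite: AlbrittonBarker2019, Thm 1.2 (arXiv:1811.00502 p. 4)] -/
theorem oseenMild_const_of_backward_finiteEnergy_const
    (v : ℝ → EuclideanSpace ℝ (Fin 3) → EuclideanSpace ℝ (Fin 3)) (b : EuclideanSpace ℝ (Fin 3))
    (hvc : ContinuousOn (uncurry v) (Iio 0 ×ˢ univ))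
    (hvK : ∃ K : ℝ, ∀ t < 0, ∀ x, ‖v t x‖ ≤ K)
    (hvd : ∀ t < 0, IsWeaklyDivFree (v t))
    (hvm : ∀ s t : ℝ, s < t → t < 0 → ∀ x,
      v t x = UnboundedOperators.heatExtension (v s) (t - s) x - oseenDuhamel 1 s v v t x)
    (hL2 : ∃ (τ : ℕ → ℝ) (M : ℝ≥0∞), M < ∞ ∧ Tendsto τ atTop atBot ∧ (∀ k, τ k < 0) ∧
      ∀ k, eLpNorm (fun x => v (τ k) x - b) 2 (volume : Measure (EuclideanSpace ℝ (Fin 3))) ≤ M) :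
    ∀ t < 0, ∀ x, v t x = b :=
  oseenMild_const_of_backward_Lp_const v b (p := 2) two_ne_zero (by norm_num) hvc hvK hvd hvm hL2

/-- **The `Lᵖ` variant of the registered stub S3ᵐ, `0 < p ≤ 3`, implies S3ᵐ verbatim.** If every
mild bounded ancient solution outside the Type-I regime is `Lᵖ`-close (`≤ M`) to constants `b_k`
along some `τ_k → −∞`, then it is `L³`-close (`≤ M^{p/3}(2K)^{1−p/3}`) to the same constants along
the same times: `‖b_k‖ ≤ K` by `norm_const_le_of_eLpNorm_sub_lt_top`, so the pointwise bound `2K`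
is uniform in `k`, and `Lᵖ ∩ L^∞ ⊂ L³` quantitatively. In particular the energy-class statement
(`p = 2`) suffices to close `stub_persistent_mild_backward_L3_recurrence`. -/
theorem persistentMild_of_persistentLp {p : ℝ≥0∞} (hp0 : p ≠ 0) (hp3 : p ≤ 3)
    (hSp : ∀ v : ℝ → EuclideanSpace ℝ (Fin 3) → EuclideanSpace ℝ (Fin 3),
      ContinuousOn (uncurry v) (Iio 0 ×ˢ univ) →
      (∃ K : ℝ, ∀ t < 0, ∀ x, ‖v t x‖ ≤ K) →
      (∀ t < 0, Literature.Analysis.FluidPDE.IsWeaklyDivFree (v t)) →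
      (∀ s t : ℝ, s < t → t < 0 → ∀ x,
        v t x = Literature.Analysis.UnboundedOperators.heatExtension (v s) (t - s) x -
          Literature.Analysis.FluidPDE.oseenDuhamel 1 s v v t x) →
      (¬ ∃ C : ℝ, ∀ t < 0, ∀ x, ‖v t x‖ ≤ C / Real.sqrt (-t)) →
      ∃ (b : ℕ → EuclideanSpace ℝ (Fin 3)) (τ : ℕ → ℝ) (M : NNReal),
        (∀ k, τ k < 0) ∧ Tendsto τ atTop atBot ∧
        ∀ k, eLpNorm (fun x => v (τ k) x - b k) p
          (volume : Measure (EuclideanSpace ℝ (Fin 3))) ≤ (M : ENNReal)) :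
    ∀ v : ℝ → EuclideanSpace ℝ (Fin 3) → EuclideanSpace ℝ (Fin 3),
      ContinuousOn (uncurry v) (Iio 0 ×ˢ univ) →
      (∃ K : ℝ, ∀ t < 0, ∀ x, ‖v t x‖ ≤ K) →
      (∀ t < 0, Literature.Analysis.FluidPDE.IsWeaklyDivFree (v t)) →
      (∀ s t : ℝ, s < t → t < 0 → ∀ x,
        v t x = Literature.Analysis.UnboundedOperators.heatExtension (v s) (t - s) x -
          Literature.Analysis.FluidPDE.oseenDuhamel 1 s v v t x) →
      (¬ ∃ C : ℝ, ∀ t < 0, ∀ x, ‖v t x‖ ≤ C / Real.sqrt (-t)) →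
      ∃ (b : ℕ → EuclideanSpace ℝ (Fin 3)) (τ : ℕ → ℝ) (M : NNReal),
        (∀ k, τ k < 0) ∧ Tendsto τ atTop atBot ∧
        ∀ k, eLpNorm (fun x => v (τ k) x - b k) 3
          (volume : Measure (EuclideanSpace ℝ (Fin 3))) ≤ (M : ENNReal) := by
  intro v hvc hvK hvd hvm hpers
  obtain ⟨b, τ, M, hτ0, hτlim, hLp⟩ := hSp v hvc hvK hvd hvm hpers
  obtain ⟨K, hK⟩ := hvK
  have hpt : p ≠ ∞ := ne_top_of_le_ne_top (by norm_num) hp3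
  have hvcont : ∀ k, Continuous (v (τ k)) := fun k =>
    hvc.comp_continuous (Continuous.prodMk_right (τ k)) fun x => mem_prod.2 ⟨hτ0 k, mem_univ x⟩
  -- the constants are bounded by `K`
  have hbK : ∀ k, ‖b k‖ ≤ K := fun k =>
    norm_const_le_of_eLpNorm_sub_lt_top (fun x => hK _ (hτ0 k) x) hp0 hpt
      ((hLp k).trans_lt ENNReal.coe_lt_top)
  have hA : ∀ k x, ‖v (τ k) x - b k‖ ≤ 2 * K := fun k x => by
    have := (norm_sub_le (v (τ k) x) (b k)).trans (add_le_add (hK _ (hτ0 k) x) (hbK k))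
    linarith
  set M' : ℝ≥0∞ := (M : ℝ≥0∞) ^ (p.toReal / (3 : ℝ≥0∞).toReal) *
    ENNReal.ofReal (2 * K) ^ (1 - p.toReal / (3 : ℝ≥0∞).toReal) with hM'
  have hM'top : M' < ∞ :=
    ENNReal.mul_lt_top (ENNReal.rpow_lt_top_of_nonneg (exponents_nonneg hp3).1 ENNReal.coe_ne_top)
      (ENNReal.rpow_lt_top_of_nonneg (exponents_nonneg hp3).2 ENNReal.ofReal_ne_top)
  refine ⟨b, τ, M'.toNNReal, hτ0, hτlim, fun k => ?_⟩
  rw [ENNReal.coe_toNNReal hM'top.ne]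
  exact eLpNorm_three_le_of_eLpNorm_le ((hvcont k).sub continuous_const).aestronglyMeasurable
    (hA k) hp0 hp3 (hLp k)

/-- **Conversely, for `3 ≤ p < ∞` the registered S3ᵐ implies its `Lᵖ` variant** (same constants
and times; `L³ ∩ L^∞ ⊂ Lᵖ` quantitatively with the uniform pointwise bound `2K`). Together with
`persistentMild_of_persistentLp`: the family of `Lᵖ`-recurrence statements is monotone in
`p ∈ (0, ∞)`. -/
theorem persistentLp_of_persistentMild {p : ℝ≥0∞} (h3p : 3 ≤ p) (hpt : p ≠ ∞)
    (hS3 : ∀ v : ℝ → EuclideanSpace ℝ (Fin 3) → EuclideanSpace ℝ (Fin 3),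
      ContinuousOn (uncurry v) (Iio 0 ×ˢ univ) →
      (∃ K : ℝ, ∀ t < 0, ∀ x, ‖v t x‖ ≤ K) →
      (∀ t < 0, Literature.Analysis.FluidPDE.IsWeaklyDivFree (v t)) →
      (∀ s t : ℝ, s < t → t < 0 → ∀ x,
        v t x = Literature.Analysis.UnboundedOperators.heatExtension (v s) (t - s) x -
          Literature.Analysis.FluidPDE.oseenDuhamel 1 s v v t x) →
      (¬ ∃ C : ℝ, ∀ t < 0, ∀ x, ‖v t x‖ ≤ C / Real.sqrt (-t)) →
      ∃ (b : ℕ → EuclideanSpace ℝ (Fin 3)) (τ : ℕ → ℝ) (M : NNReal),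
        (∀ k, τ k < 0) ∧ Tendsto τ atTop atBot ∧
        ∀ k, eLpNorm (fun x => v (τ k) x - b k) 3
          (volume : Measure (EuclideanSpace ℝ (Fin 3))) ≤ (M : ENNReal)) :
    ∀ v : ℝ → EuclideanSpace ℝ (Fin 3) → EuclideanSpace ℝ (Fin 3),
      ContinuousOn (uncurry v) (Iio 0 ×ˢ univ) →
      (∃ K : ℝ, ∀ t < 0, ∀ x, ‖v t x‖ ≤ K) →
      (∀ t < 0, Literature.Analysis.FluidPDE.IsWeaklyDivFree (v t)) →
      (∀ s t : ℝ, s < t → t < 0 → ∀ x,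
        v t x = Literature.Analysis.UnboundedOperators.heatExtension (v s) (t - s) x -
          Literature.Analysis.FluidPDE.oseenDuhamel 1 s v v t x) →
      (¬ ∃ C : ℝ, ∀ t < 0, ∀ x, ‖v t x‖ ≤ C / Real.sqrt (-t)) →
      ∃ (b : ℕ → EuclideanSpace ℝ (Fin 3)) (τ : ℕ → ℝ) (M : NNReal),
        (∀ k, τ k < 0) ∧ Tendsto τ atTop atBot ∧
        ∀ k, eLpNorm (fun x => v (τ k) x - b k) p
          (volume : Measure (EuclideanSpace ℝ (Fin 3))) ≤ (M : ENNReal) := by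
  intro v hvc hvK hvd hvm hpers
  obtain ⟨b, τ, M, hτ0, hτlim, hL3⟩ := hS3 v hvc hvK hvd hvm hpers
  obtain ⟨K, hK⟩ := hvK
  have hvcont : ∀ k, Continuous (v (τ k)) := fun k =>
    hvc.comp_continuous (Continuous.prodMk_right (τ k)) fun x => mem_prod.2 ⟨hτ0 k, mem_univ x⟩
  have hbK : ∀ k, ‖b k‖ ≤ K := fun k =>
    norm_const_le_of_eLpNorm_sub_lt_top (fun x => hK _ (hτ0 k) x) (p := 3) (by norm_num)
      (by norm_num) ((hL3 k).trans_lt ENNReal.coe_lt_top)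
  have hA : ∀ k x, ‖v (τ k) x - b k‖ ≤ 2 * K := fun k x => by
    have := (norm_sub_le (v (τ k) x) (b k)).trans (add_le_add (hK _ (hτ0 k) x) (hbK k))
    linarith
  have hp0 : (3 : ℝ≥0∞) ≠ 0 := by norm_num
  have hexp1 : 0 ≤ (3 : ℝ≥0∞).toReal / p.toReal := by positivity
  have hexp2 : 0 ≤ 1 - (3 : ℝ≥0∞).toReal / p.toReal := by
    have hp0' : p ≠ 0 := (lt_of_lt_of_le (by norm_num : (0 : ℝ≥0∞) < 3) h3p).ne'
    have hb : 0 < p.toReal := ENNReal.toReal_pos hp0' hpt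
    have hab : (3 : ℝ≥0∞).toReal ≤ p.toReal := (ENNReal.toReal_le_toReal (by norm_num) hpt).2 h3p
    rw [sub_nonneg, div_le_one hb]
    exact hab
  set M' : ℝ≥0∞ := (M : ℝ≥0∞) ^ ((3 : ℝ≥0∞).toReal / p.toReal) *
    ENNReal.ofReal (2 * K) ^ (1 - (3 : ℝ≥0∞).toReal / p.toReal) with hM'
  have hM'top : M' < ∞ :=
    ENNReal.mul_lt_top (ENNReal.rpow_lt_top_of_nonneg hexp1 ENNReal.coe_ne_top)
      (ENNReal.rpow_lt_top_of_nonneg hexp2 ENNReal.ofReal_ne_top)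
  refine ⟨b, τ, M'.toNNReal, hτ0, hτlim, fun k => ?_⟩
  rw [ENNReal.coe_toNNReal hM'top.ne]
  exact (eLpNorm_le_rpow_mul_rpow_of_norm_le ((hvcont k).sub continuous_const).aestronglyMeasurable
    (hA k) hp0 h3p).trans (mul_le_mul' (ENNReal.rpow_le_rpow (hL3 k) hexp1) le_rfl)

end Summit.NavierStokesRegularity.NavierStokesRegularity.Theorems
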